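import Summits.HubbardSuperconductivity.HubbardSuperconductivity.Theorems.SoloBlindCertificateFromGroundGap
import Literature.MathematicalPhysics.QuantumLattice.SectorGroundProjContinuity
import Literature.MathematicalPhysics.QuantumLattice.FreeFermiGasNoThermalPairFieldLRO
import HarnessLib

/-!
# The gap above the ground multiplet of an invariant sector; the variational blueprint is
necessary

Companion to `SoloBlindTrialSubspaceTransfer`. Two facts of finite-dimensional spectral theory in
the `dotProduct` language of the tree, and their consequence for the summit:

* `exists_gap_above_groundEigenspace` — for Hermitian `H` and an `H`-invariant subspace `S` with
  sector energy `E₀ = minEnergyOn H S`, there is `γ > 0` with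
  `γ‖w‖² ≤ re⟨w,Hw⟩ - E₀‖w‖²` for every `w ∈ S` orthogonal to all `E₀`-eigenvectors in `S`
  (the orthogonal complement `W` of the ground multiplet inside `S` is invariant; its own sector
  energy is attained at an eigenvector, which cannot be a ground state; so `minEnergyOn H W > E₀`).
* `groundState_order_of_unit_bound` — a lower bound `a ≤ ‖Aφ‖²` on UNIT eigenvectors is the
  homogeneous bound `a‖φ‖² ≤ ‖Aφ‖²` on all of them.
* `trialSubspaces_of_hubbardSuperconductivity` — the VARIATIONAL BLUEPRINT of
  `SoloBlindTrialSubspaceTransfer` (trial subspaces `T_L ≤ S_L` with d-wave order `cL⁴`, energies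
  `≤ E₀ + η_L`, a gap `γ_L > 0` above the ground multiplet inside the sector, `1600 η_L ≤ c γ_L`,
  and COVER) is NECESSARY for `HubbardSuperconductivity` (take `T_L` = the ground eigenspace,
  `η_L = 0`, `γ_L` = the gap of this file); with `hubbardSuperconductivity_of_trialSubspaces` of
  that file the blueprint is therefore EQUIVALENT to the summit.

References: Reed–Simon IV §XIII.1 (min–max); Tasaki (2020) §2.2; tree lemmas
`exists_unit_eigen_minEnergyOn`, `minEnergyOn_mul_le_re_rayleigh` (`SectorGroundProjContinuity`).
-/

namespace Summit.HubbardSuperconductivity.HubbardSuperconductivity.Theorems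

open Matrix Finset Literature.MathematicalPhysics.QuantumLattice
  Literature.MathematicalPhysics.QuantumFieldTheory GaugeTwist WithLp
open scoped ComplexConjugate ComplexOrder

section Abstract

variable {n : Type*} [Fintype n]

/-- `⟨ψ, Hw⟩ = ⟨Hψ, w⟩` for Hermitian `H`. [folklore] -/
theorem star_dotProduct_mulVec_of_isHermitian {H : Matrix n n ℂ} (hH : H.IsHermitian)
    (ψ w : n → ℂ) : star ψ ⬝ᵥ (H *ᵥ w) = star (H *ᵥ ψ) ⬝ᵥ w := by
  rw [dotProduct_mulVec, star_mulVec, hH.eq]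

/-- **Gap above the ground multiplet of an invariant sector.** For Hermitian `H` and an
`H`-invariant subspace `S`, with `E₀ = minEnergyOn H S`: there is `γ > 0` such that every `w ∈ S`
orthogonal to all `E₀`-eigenvectors of `H` in `S` has `γ‖w‖² ≤ re⟨w,Hw⟩ - E₀‖w‖²`. (If the
orthogonal complement `W` of the ground multiplet in `S` is trivial any `γ` works; otherwise `W` is
invariant, `minEnergyOn H W` is attained at an eigenvector in `W`, which would be a ground state
orthogonal to itself if `minEnergyOn H W = E₀`.) Finite-dimensional min–max, Reed–Simon IV
§XIII.1; Tasaki (2020) §2.2. [folklore] -/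
theorem exists_gap_above_groundEigenspace {H : Matrix n n ℂ} (hH : H.IsHermitian)
    (S : Submodule ℂ (n → ℂ)) (hinv : ∀ v ∈ S, H *ᵥ v ∈ S) :
    ∃ γ : ℝ, 0 < γ ∧ ∀ w ∈ S,
      (∀ ψ ∈ S, H *ᵥ ψ = ((H.minEnergyOn S : ℝ) : ℂ) • ψ → star ψ ⬝ᵥ w = 0) →
        γ * (star w ⬝ᵥ w).re ≤
          (star w ⬝ᵥ (H *ᵥ w)).re - H.minEnergyOn S * (star w ⬝ᵥ w).re := by
  set E₀ : ℝ := H.minEnergyOn S with hE₀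
  let W : Submodule ℂ (n → ℂ) :=
    { carrier := {w | w ∈ S ∧ ∀ ψ ∈ S, H *ᵥ ψ = (E₀ : ℂ) • ψ → star ψ ⬝ᵥ w = 0}
      zero_mem' := ⟨S.zero_mem, fun ψ _ _ => dotProduct_zero _⟩
      add_mem' := by
        rintro x y ⟨hxS, hx⟩ ⟨hyS, hy⟩
        exact ⟨S.add_mem hxS hyS, fun ψ hψS hψ => by
          rw [dotProduct_add, hx ψ hψS hψ, hy ψ hψS hψ, add_zero]⟩
      smul_mem' := by
        rintro c x ⟨hxS, hx⟩
        exact ⟨S.smul_mem c hxS, fun ψ hψS hψ => by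
          rw [dotProduct_smul, hx ψ hψS hψ, smul_zero]⟩ }
  have hmem : ∀ w, w ∈ W ↔ w ∈ S ∧ ∀ ψ ∈ S, H *ᵥ ψ = (E₀ : ℂ) • ψ → star ψ ⬝ᵥ w = 0 :=
    fun _ => Iff.rfl
  have hWinv : ∀ w ∈ W, H *ᵥ w ∈ W := by
    intro w hw
    rw [hmem] at hw ⊢
    refine ⟨hinv w hw.1, fun ψ hψS hψ => ?_⟩
    rw [star_dotProduct_mulVec_of_isHermitian hH, hψ, star_smul, smul_dotProduct, hw.2 ψ hψS hψ,
      smul_zero]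
  by_cases hbot : W = ⊥
  · refine ⟨1, one_pos, fun w hwS hw => ?_⟩
    have hwW : w ∈ W := (hmem w).2 ⟨hwS, hw⟩
    rw [hbot, Submodule.mem_bot] at hwW
    subst hwW
    simp
  obtain ⟨w₁, hw₁W, hw₁1, hw₁⟩ := exists_unit_eigen_minEnergyOn hH W hWinv hbot
  set E₁ : ℝ := H.minEnergyOn W with hE₁
  have hw₁S : w₁ ∈ S := ((hmem w₁).1 hw₁W).1
  have h01 : E₀ ≤ E₁ := by
    have h := minEnergyOn_mul_le_re_rayleigh hH S hw₁S
    rw [hw₁, dotProduct_smul, hw₁1, smul_eq_mul, mul_one, Complex.ofReal_re, Complex.one_re,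
      mul_one] at h
    exact h
  have hne : E₀ ≠ E₁ := by
    intro heq
    have hV : H *ᵥ w₁ = (E₀ : ℂ) • w₁ := by rw [heq]; exact hw₁
    have h0 := ((hmem w₁).1 hw₁W).2 w₁ hw₁S hV
    rw [hw₁1] at h0
    exact one_ne_zero h0
  refine ⟨E₁ - E₀, sub_pos.2 (lt_of_le_of_ne h01 hne), fun w hwS hw => ?_⟩
  have h := minEnergyOn_mul_le_re_rayleigh hH W ((hmem w).2 ⟨hwS, hw⟩)
  rw [sub_mul]
  linarith

/-- A lower bound `a ≤ ‖Aφ‖²` on the UNIT `E₀`-eigenvectors of `H` in `S` is the homogeneous bound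
`a‖φ‖² ≤ ‖Aφ‖²` on all `E₀`-eigenvectors of `H` in `S` (normalise). [folklore] -/
theorem groundState_order_of_unit_bound (H A : Matrix n n ℂ) (S : Submodule ℂ (n → ℂ)) (E₀ a : ℝ)
    (h : ∀ φ ∈ S, φ ≠ 0 → star φ ⬝ᵥ φ = 1 → H *ᵥ φ = (E₀ : ℂ) • φ →
      a ≤ (star (A *ᵥ φ) ⬝ᵥ (A *ᵥ φ)).re) :
    ∀ φ ∈ S, H *ᵥ φ = (E₀ : ℂ) • φ →
      a * (star φ ⬝ᵥ φ).re ≤ (star (A *ᵥ φ) ⬝ᵥ (A *ᵥ φ)).re := by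
  intro φ hφS hφ
  by_cases h0 : φ = 0
  · subst h0; simp
  obtain ⟨c, hc0, hc1⟩ := exists_smul_unit h0
  have hb := h (c • φ) (S.smul_mem c hφS) (smul_ne_zero hc0 h0) hc1
    (by rw [mulVec_smul, hφ, smul_comm])
  have hcc : star c * c = ((‖c‖ ^ 2 : ℝ) : ℂ) := by
    rw [Complex.star_def, Complex.conj_mul']; push_cast; rfl
  rw [mulVec_smul, star_smul, smul_dotProduct, dotProduct_smul, smul_smul, hcc, smul_eq_mul,
    Complex.re_ofReal_mul] at hb
  rw [star_smul, smul_dotProduct, dotProduct_smul, smul_smul, hcc, smul_eq_mul] at hc1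
  have h1 : ‖c‖ ^ 2 * (star φ ⬝ᵥ φ).re = 1 := by
    have := congrArg Complex.re hc1
    rwa [Complex.re_ofReal_mul, Complex.one_re] at this
  have hpos : 0 < ‖c‖ ^ 2 := by positivity
  refine le_of_mul_le_mul_left ?_ hpos
  calc ‖c‖ ^ 2 * (a * (star φ ⬝ᵥ φ).re) = a * (‖c‖ ^ 2 * (star φ ⬝ᵥ φ).re) := by ring
    _ = a := by rw [h1, mul_one]
    _ ≤ _ := hb

end Abstract

section Hubbard

variable {L : ℕ}

/-- **The sector gap above the ground multiplet on the Hubbard torus**: for any `t, U`, any joint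
sector `(N, S^z)` of Fock space and `E₀` its sector energy, some `γ > 0` bounds
`re⟨w,Hw⟩ - E₀‖w‖² ≥ γ‖w‖²` for every `w` in the sector orthogonal to all sector ground states.
[folklore] -/
theorem exists_gap_above_groundStates_hubbardTorus (t U : ℝ) (N : ℕ) (M : ℝ) :
    ∃ γ : ℝ, 0 < γ ∧ ∀ w ∈ szSector (Λ := FermionTorus 2 L) N M,
      (∀ ψ, IsGroundStateInSector (hubbardTorus 2 L t U) N M ψ → star ψ ⬝ᵥ w = 0) →
        γ * (star w ⬝ᵥ w).re ≤ (star w ⬝ᵥ (hubbardTorus 2 L t U *ᵥ w)).re -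
          (hubbardTorus 2 L t U).minEnergyOn (szSector N M) * (star w ⬝ᵥ w).re := by
  obtain ⟨γ, hγ, h⟩ := exists_gap_above_groundEigenspace (isHermitian_hubbardTorus L t U)
    (szSector (Λ := FermionTorus 2 L) N M) fun v hv => hubbardTorus_mulVec_mem_szSector t U hv
  refine ⟨γ, hγ, fun w hwS hw => h w hwS fun ψ hψS hψ => ?_⟩
  by_cases h0 : ψ = 0
  · rw [h0, star_zero, zero_dotProduct]
  exact hw ψ ⟨hψS, h0, hψ⟩

end Hubbard

/-! ### The variational blueprint is an equivalence -/

/-- **`HubbardSuperconductivity` ⟹ the variational blueprint** (so, with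
`hubbardSuperconductivity_of_trialSubspaces`, the blueprint is EQUIVALENT to the summit). If the
summit holds then for some `U > 0`, `δ ∈ (0,1/2)`, `c > 0`, `L₀`, at every even side
`L = n+1 ≥ L₀` — with `H = hubbardTorus 2 L 1 U`, `S` the sector `(2⌊(1-δ)L²/2⌋, S^z = 0)`,
`E₀ = minEnergyOn H S` — there are a trial subspace `T ≤ S` and `η`, `γ > 0` with `1600η ≤ cγ`
such that: (ORDER) `cL⁴‖φ‖² ≤ re⟨φ,(√2Δ_d)†(√2Δ_d)φ⟩` on `T`; (ENERGY)
`re⟨φ,Hφ⟩ - E₀‖φ‖² ≤ η‖φ‖²` on `T`; (GAP) `γ‖w‖² ≤ re⟨w,Hw⟩ - E₀‖w‖²` for `w ∈ S` orthogonal to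
all sector ground states; (COVER) every sector ground state overlaps `T`. (Proof: `T` = the ground
eigenspace, `η = 0`, `γ` from `exists_gap_above_groundStates_hubbardTorus`.) [this work] -/
theorem trialSubspaces_of_hubbardSuperconductivity (hS : HubbardSuperconductivity) :
      ∃ U : ℝ, 0 < U ∧ ∃ δ ∈ Set.Ioo (0 : ℝ) (1 / 2), ∃ c : ℝ, 0 < c ∧ ∃ L₀ : ℕ,
        ∀ n : ℕ, Even (n + 1) → L₀ ≤ n + 1 →
          ∃ (T : Submodule ℂ (Fock (Orb (FermionTorus 2 (n + 1))))) (η γ : ℝ), 0 < γ ∧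
            1600 * η ≤ c * γ ∧
            T ≤ szSector (Λ := FermionTorus 2 (n + 1))
              (2 * ⌊(1 - δ) * ((n + 1 : ℕ) : ℝ) ^ 2 / 2⌋₊) 0 ∧
            (∀ φ ∈ T, c * ((n + 1 : ℕ) : ℝ) ^ 4 * (star φ ⬝ᵥ φ).re ≤ (expect
              ((pairField dWaveFormFactor (n + 1))ᴴ * pairField dWaveFormFactor (n + 1)) φ).re) ∧
            (∀ φ ∈ T, (star φ ⬝ᵥ (hubbardTorus 2 (n + 1) 1 U *ᵥ φ)).re -
                (hubbardTorus 2 (n + 1) 1 U).minEnergyOn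
                  (szSector (2 * ⌊(1 - δ) * ((n + 1 : ℕ) : ℝ) ^ 2 / 2⌋₊) 0) * (star φ ⬝ᵥ φ).re ≤
              η * (star φ ⬝ᵥ φ).re) ∧
            (∀ w ∈ szSector (Λ := FermionTorus 2 (n + 1))
                (2 * ⌊(1 - δ) * ((n + 1 : ℕ) : ℝ) ^ 2 / 2⌋₊) 0,
              (∀ ψ, IsGroundStateInSector (hubbardTorus 2 (n + 1) 1 U)
                (2 * ⌊(1 - δ) * ((n + 1 : ℕ) : ℝ) ^ 2 / 2⌋₊) 0 ψ → star ψ ⬝ᵥ w = 0) →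
              γ * (star w ⬝ᵥ w).re ≤ (star w ⬝ᵥ (hubbardTorus 2 (n + 1) 1 U *ᵥ w)).re -
                (hubbardTorus 2 (n + 1) 1 U).minEnergyOn
                  (szSector (2 * ⌊(1 - δ) * ((n + 1 : ℕ) : ℝ) ^ 2 / 2⌋₊) 0) * (star w ⬝ᵥ w).re) ∧
            (∀ ψ, IsGroundStateInSector (hubbardTorus 2 (n + 1) 1 U)
                (2 * ⌊(1 - δ) * ((n + 1 : ℕ) : ℝ) ^ 2 / 2⌋₊) 0 ψ → ∃ φ ∈ T, star φ ⬝ᵥ ψ ≠ 0) := by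
  obtain ⟨U, hU, δ, hδ, c, hc, L₀, hb⟩ := uniform_dWave_bound_of_hubbardSuperconductivity hS
  refine ⟨U, hU, δ, hδ, c, hc, L₀, fun n hn hL => ?_⟩
  set H := hubbardTorus 2 (n + 1) 1 U
  set N : ℕ := 2 * ⌊(1 - δ) * ((n + 1 : ℕ) : ℝ) ^ 2 / 2⌋₊ with hN
  obtain ⟨γ, hγ, hgap⟩ := exists_gap_above_groundStates_hubbardTorus (L := n + 1) 1 U N 0
  let V : Submodule ℂ (Fock (Orb (FermionTorus 2 (n + 1)))) :=
    { carrier := {ψ | ψ ∈ szSector N 0 ∧ H *ᵥ ψ = ((H.minEnergyOn (szSector N 0) : ℝ) : ℂ) • ψ}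
      zero_mem' := by simp
      add_mem' := by
        rintro x y ⟨hxS, hx⟩ ⟨hyS, hy⟩
        exact ⟨Submodule.add_mem _ hxS hyS, by rw [mulVec_add, hx, hy, smul_add]⟩
      smul_mem' := by
        rintro a x ⟨hxS, hx⟩
        exact ⟨Submodule.smul_mem _ a hxS, by rw [mulVec_smul, hx, smul_comm]⟩ }
  have hmem : ∀ ψ, ψ ∈ V ↔
      ψ ∈ szSector N 0 ∧ H *ᵥ ψ = ((H.minEnergyOn (szSector N 0) : ℝ) : ℂ) • ψ :=
    fun _ => Iff.rfl
  refine ⟨V, 0, γ, hγ, by rw [mul_zero]; positivity, fun φ hφ => ((hmem φ).1 hφ).1, fun φ hφ => ?_,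
    fun φ hφ => ?_, hgap, fun ψ hgs => ?_⟩
  · -- ORDER on `V`, from the unit-vector bound of the finite-volume criterion
    rw [hmem] at hφ
    rw [PosSemidefTrace.expect_conjTranspose_mul]
    refine groundState_order_of_unit_bound H (pairField dWaveFormFactor (n + 1)) (szSector N 0)
      _ (c * ((n + 1 : ℕ) : ℝ) ^ 4) (fun ψ hψS hψ0 hψ1 hψ => ?_) φ hφ.1 hφ.2
    rw [← PosSemidefTrace.expect_conjTranspose_mul]
    exact hb n hn hL ψ hψ1 ⟨hψS, hψ0, hψ⟩
  · -- ENERGY on `V`: exactly `E₀`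
    rw [hmem] at hφ
    rw [hφ.2, dotProduct_smul, smul_eq_mul, Complex.re_ofReal_mul, zero_mul, sub_self]
  · -- COVER: a ground state is not orthogonal to itself
    exact ⟨ψ, (hmem ψ).2 ⟨hgs.1, hgs.2.2⟩, fun h => hgs.2.1 (dotProduct_star_self_eq_zero.1 h)⟩

end Summit.HubbardSuperconductivity.HubbardSuperconductivity.Theorems
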